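import Mathlib
import HarnessLib
import Summits.NavierStokesRegularity.NavierStokesRegularity.Theorems.LocalHelicityTubeDoorFrobeniusProfileRigiditySharper
import Summits.NavierStokesRegularity.NavierStokesRegularity.Theorems.LocalHelicityTubeDoorFrobeniusProfileRigidityScrewSlice
import Summits.NavierStokesRegularity.NavierStokesRegularity.Theorems.LocalSineTubeDoorOneDirectionDoor
import Summits.NavierStokesRegularity.NavierStokesRegularity.Theorems.LocalHelicityTubeDoorTarget
import Summits.NavierStokesRegularity.NavierStokesRegularity.Theorems.DssFarFieldSlavingBlowupTypeIDssProfileTiltedIsotropyCalculus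

/-!
# Door S11 `LocalTubeDoorHelicity` (nsreg-p1 ROUND-11/13), profile crux K2⁗ `FrobeniusProfileRigidity` —
# the GERM QUADRICHOTOMY SUFFICES: every alternative of the line's slice quadrichotomy may be checked on a
# nonempty open WINDOW of ONE slice

Cell ns-regularity-ideate, seat p6 (route-directed support for the door route `route-helicity` staged by nsreg-p1 g11;
lands `--supports` the K2⁗ item; no claim on the crux).  The line of record for K2⁗ (BC3 birth skeleton
`bc/FrobeniusProfileRigidity_birth.lean`) is the SLICE QUADRICHOTOMY: every helicity-free profile of the Type-I class has
some slice `s < 0` on which (1) the vorticity is parallel to a fixed direction, or (2) the slice is translation-invariant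
along a line, or (3) it is axisymmetric without swirl about some axis, or (4) its vorticity is an affine screw field on a
ball — alternatives (1)–(3) being GLOBAL statements about the whole slice.  nsreg-p1's ROUND-12 plan split it
into (i) «which germs occur» and (ii) «germ → slice spreading by real analyticity of Oseen-mild slices».  This file IS
step (ii), kernel-checked once and for all (for the status of step (i) — NOT a jet-level classification, which is false
in print — see the CAUTION paragraph below):

* `isAxisymmetric_of_fderiv_rotGen_window` / `hasNoSwirl_of_window` — for a real-analytic field `w` on `ℝ³`, the
  INFINITESIMAL axisymmetry `Dw(y)[J y] = J w(y)` (`J = rotGen`, the rotation generator about the `x₂`-axis) and the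
  no-swirl condition `swirl w y = 0` on a nonempty open window propagate to all of `ℝ³` (identity theorem; both sides
  are real-analytic), and the former integrates to `IsAxisymmetric w` (tree `isAxisymmetric_of_fderiv_rotGen`:
  `θ ↦ R_{−θ} w(R_θ y)` has zero derivative);
* `eq_zero_of_axisymmetric_noSwirl_germ_anyAxis_slice` — **alternative (3) in germ form**: if for some rigid frame
  (`L`, `c`) the conjugated slice `y ↦ L⁻¹ v(s, L y + c)` of a profile of the Type-I class is infinitesimally
  axisymmetric and swirl-free on a nonempty open window, then `v ≡ 0` (the conjugated profile is in the class, tree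
  `class_translate` + `class_conj_linearIsometryEquiv`, so its slice is real-analytic, tree `analyticOnNhd_slice`; then
  the tree's `eq_zero_of_axisymmetric_noSwirl_anyAxis_slice`, KNSS 2009 Thm 5.2 in the class);
* `frobeniusProfileRigidity_of_germQuadrichotomy` — **K2⁗ (profile form, = the `hprofile` hypothesis of the tree
  theorem `localTubeDoorHelicity_of_profileRigidity`, verbatim) ⇐ the GERM QUADRICHOTOMY**: it suffices that every
  helicity-free profile of the class has ONE slice `s < 0` and ONE nonempty open window `U` on which (1) `curl v(s) × b
  = 0` for a fixed `b ≠ 0` (tree `eq_zero_of_aligned_window`), or (2) `∂ₑ v(s) = 0` for a fixed `e ≠ 0` (tree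
  `oneSliceCrux_dirDerivNorm`, the S13 one-slice crux), or (3) the germ form of axisymmetry-without-swirl about some
  axis (this file), or (4) `curl v(s)` is an affine screw field (tree `eq_zero_of_screwVorticityBall`, nsreg-p5 g7);
* `localTubeDoorHelicity_of_germQuadrichotomy` — hence **the S11 leaf ⇐ the germ quadrichotomy** (tree
  `localTubeDoorHelicity_of_profileRigidity`).

So after this file the registered stub 1 of the K2⁗ line may be replaced by its GERM form without any further Lean
work on the spreading step.

CAUTION on what remains open (nsreg-lit LIT-PACK v11 §R41/§R47/§R52, nsreg-p1 ROUND-13 §1(B)/§3, refuter1 p475623): it is a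
GLOBAL-TO-GERM statement — «every helicity-free profile OF THE TYPE-I CLASS exhibits one of the germs (1)–(4) on some
window of some slice» — and NOT a purely local (jet-level) classification of the exterior differential system
{NS, div v = 0, v · curl v = 0}, which is FALSE in print: Šverák's conformal (−1)-homogeneous family `u = ∇Φ − (ΔΦ) y`
(arXiv:math/0604550 §4; arXiv:2509.07243 §2.1.3) is complex-lamellar and real-analytic off a half-axis with germs outside
all four alternatives, and Marris–Ames 1977 (I.2) is why alternative (4) exists; both families leave the class only by
UNBOUNDEDNESS (`|u| ∼ 1/r`, resp. linear growth), and the in-class-minus-Oseen-mild version of the quadrichotomy is false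
too (refuter1 `…/Negative/OffFourStrata.lean`, `sliceQuadrichotomy_false_without_mild`).  Any proof must therefore turn
global information (boundedness, the Type-I rate, ancientness and the Oseen–Duhamel identity) into one of the four germs
somewhere; this file only guarantees that «somewhere» may be ONE window of ONE slice.

SUPPORT EDGE (route-NavierStokesRegularity-LocalHelicityTubeDoor born; director-ns g6 #1 (5)): this file is re-pointed
`--supports stmt-NavierStokesRegularity-19975 --as helper` (nsreg-p6 g6 p475626/p476563: germ quadrichotomy ⇒ K2⁗); it was parked on the
CLOSED fallback anchor stmt-NavierStokesRegularity-20018 while the route was unborn.  Declarations unchanged.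

WHAT THIS IS NOT: not a claim about Navier–Stokes regularity and not K2⁗ (the germ quadrichotomy is OPEN) — the
analytic-continuation half of the line, for a door route whose leaf is a LOCAL regularity criterion conditional on local
Type I (bears_on LADDER-NS N0, door S11).
-/

noncomputable section

-- the summit and its single sub-problem share the name (CONVENTIONS §1), as in every Theorems file
set_option linter.dupNamespace false

namespace Summit.NavierStokesRegularity.NavierStokesRegularity.Theorems.LocalHelicityTubeDoorFrobeniusProfileRigidityGermQuadrichotomy

open MeasureTheory Set Function Filter Topology TopologicalSpace Metric
open scoped RealInnerProductSpace InnerProductSpace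
open Literature.Analysis Literature.Analysis.FluidPDE
open Summit.NavierStokesRegularity.NavierStokesRegularity.Theorems.LocalSineTubeDoorProfileAlignedWindowRigidityAncient
open Summit.NavierStokesRegularity.NavierStokesRegularity.Theorems.LocalSineTubeDoorProfileAlignedWindowRigidity
open Summit.NavierStokesRegularity.NavierStokesRegularity.Theorems.PoloidalWindowDoorPoloidalWindowRigidityFlat
open Summit.NavierStokesRegularity.NavierStokesRegularity.Theorems.PoloidalWindowDoorPoloidalWindowRigidityRotate
open Summit.NavierStokesRegularity.NavierStokesRegularity.Theorems.PoloidalWindowDoorPoloidalWindowRigidityAxisymmetric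
open Summit.NavierStokesRegularity.NavierStokesRegularity.Theorems.LocalHelicityTubeDoorFrobeniusProfileRigiditySharper
open Summit.NavierStokesRegularity.NavierStokesRegularity.Theorems.LocalHelicityTubeDoorFrobeniusProfileRigidityScrewSlice
open Summit.NavierStokesRegularity.NavierStokesRegularity.Theorems.LocalSineTubeDoorOneDirectionDoor
open Summit.NavierStokesRegularity.NavierStokesRegularity.Theorems.LocalHelicityTubeDoorTarget
open Summit.NavierStokesRegularity.NavierStokesRegularity.Theorems.TiltedIsotropy

variable {C : ℝ} {v : ℝ → EuclideanSpace ℝ (Fin 3) → EuclideanSpace ℝ (Fin 3)}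

/-! ### Germ → everywhere for infinitesimal axisymmetry and no swirl of a real-analytic field -/

/-- For a real-analytic field `w` on `ℝ³`, `y ↦ Dw(y)[J y]` is real-analytic (`J = rotGen`). -/
theorem analyticOnNhd_fderiv_rotGen {w : EuclideanSpace ℝ (Fin 3) → EuclideanSpace ℝ (Fin 3)}
    (hw : AnalyticOnNhd ℝ w univ) :
    AnalyticOnNhd ℝ (fun y => fderiv ℝ w y (rotGen y)) univ := by
  have hD : AnalyticOnNhd ℝ (fderiv ℝ w) univ := hw.fderiv
  have hJ : AnalyticOnNhd ℝ (fun y : EuclideanSpace ℝ (Fin 3) => rotGenL y) univ := rotGenL.analyticOnNhd _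
  intro y hy
  have h := ((ContinuousLinearMap.id ℝ (EuclideanSpace ℝ (Fin 3) →L[ℝ] EuclideanSpace ℝ (Fin 3))).analyticAt_bilinear
    (fderiv ℝ w y, rotGenL y)).comp₂ (hD y hy) (hJ y hy)
  simpa only [ContinuousLinearMap.id_apply, rotGenL_apply] using h

/-- For a real-analytic field `w` on `ℝ³`, `y ↦ J (w y)` is real-analytic. -/
theorem analyticOnNhd_rotGen_comp {w : EuclideanSpace ℝ (Fin 3) → EuclideanSpace ℝ (Fin 3)}
    (hw : AnalyticOnNhd ℝ w univ) :
    AnalyticOnNhd ℝ (fun y => rotGen (w y)) univ := by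
  have h := rotGenL.comp_analyticOnNhd hw
  simpa only [Function.comp_def, rotGenL_apply] using h

/-- For a real-analytic field `w` on `ℝ³`, its swirl `y ↦ ⟪J y, w y⟫` is real-analytic. -/
theorem analyticOnNhd_swirl {w : EuclideanSpace ℝ (Fin 3) → EuclideanSpace ℝ (Fin 3)}
    (hw : AnalyticOnNhd ℝ w univ) : AnalyticOnNhd ℝ (swirl w) univ := by
  rw [swirl_eq_inner_rotGen]
  have hJ : AnalyticOnNhd ℝ (fun y : EuclideanSpace ℝ (Fin 3) => rotGenL y) univ := rotGenL.analyticOnNhd _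
  intro y hy
  have h := ((innerSL ℝ (E := EuclideanSpace ℝ (Fin 3))).analyticAt_bilinear (rotGenL y, w y)).comp₂
    (hJ y hy) (hw y hy)
  -- `innerSL ℝ a b = ⟪a, b⟫` and `rotGenL y = rotGen y` hold by `rfl`
  exact h

/-- **Infinitesimal axisymmetry on a WINDOW integrates to axisymmetry** for a real-analytic field: if
`Dw(y)[J y] = J w(y)` on a nonempty open set, then on all of `ℝ³` (identity theorem), hence `w (R_θ y) = R_θ w(y)`
for all `θ`, `y` (tree `isAxisymmetric_of_fderiv_rotGen`). -/
theorem isAxisymmetric_of_fderiv_rotGen_window {w : EuclideanSpace ℝ (Fin 3) → EuclideanSpace ℝ (Fin 3)}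
    (hw : AnalyticOnNhd ℝ w univ) {U : Set (EuclideanSpace ℝ (Fin 3))} (hU : IsOpen U) (hne : U.Nonempty)
    (hinf : ∀ y ∈ U, fderiv ℝ w y (rotGen y) = rotGen (w y)) : IsAxisymmetric w := by
  obtain ⟨y₀, hy₀⟩ := hne
  have hg : AnalyticOnNhd ℝ (fun y => fderiv ℝ w y (rotGen y) - rotGen (w y)) univ :=
    (analyticOnNhd_fderiv_rotGen hw).sub (analyticOnNhd_rotGen_comp hw)
  have hev : (fun y => fderiv ℝ w y (rotGen y) - rotGen (w y)) =ᶠ[𝓝 y₀] 0 :=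
    Filter.eventually_of_mem (hU.mem_nhds hy₀) fun y hy => by simp [hinf y hy]
  have hall : ∀ z, fderiv ℝ w z (rotGen z) = rotGen (w z) := fun z =>
    sub_eq_zero.1 (hg.eqOn_zero_of_preconnected_of_eventuallyEq_zero isPreconnected_univ (mem_univ y₀) hev
      (mem_univ z))
  exact isAxisymmetric_of_fderiv_rotGen (fun z => (hw z (mem_univ z)).differentiableAt) hall

/-- **No swirl on a WINDOW is no swirl everywhere** for a real-analytic field. -/
theorem hasNoSwirl_of_window {w : EuclideanSpace ℝ (Fin 3) → EuclideanSpace ℝ (Fin 3)}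
    (hw : AnalyticOnNhd ℝ w univ) {U : Set (EuclideanSpace ℝ (Fin 3))} (hU : IsOpen U) (hne : U.Nonempty)
    (hsw : ∀ y ∈ U, swirl w y = 0) : HasNoSwirl w := by
  obtain ⟨y₀, hy₀⟩ := hne
  have hev : swirl w =ᶠ[𝓝 y₀] 0 :=
    Filter.eventually_of_mem (hU.mem_nhds hy₀) fun y hy => hsw y hy
  exact fun z => (analyticOnNhd_swirl hw).eqOn_zero_of_preconnected_of_eventuallyEq_zero isPreconnected_univ
    (mem_univ y₀) hev (mem_univ z)

/-! ### Alternative (3) in germ form: axisymmetric without swirl about some axis on a WINDOW of ONE slice -/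

/-- **Germ-axisymmetric-without-swirl about ANY axis on ONE slice ⇒ trivial.**  If for some rigid frame (a linear
isometry `L` and a centre `c`) and ONE `s < 0` the conjugated slice `w y = L⁻¹ v(s, L y + c)` of a profile of the Type-I
class satisfies `Dw(y)[J y] = J w(y)` and `swirl w y = 0` on a nonempty open window, then `v ≡ 0` on the slab. -/
theorem eq_zero_of_axisymmetric_noSwirl_germ_anyAxis_slice (hrate : HasTypeITimeDecay C v)
    (hcont : ContinuousOn (uncurry v) (Iio (0 : ℝ) ×ˢ univ))
    (hmild : ∀ s t : ℝ, s < t → t < 0 → ∀ x,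
      v t x = UnboundedOperators.heatExtension (v s) (t - s) x - oseenDuhamel 1 s v v t x)
    (hdiv : ∀ t < 0, VectorCalculus.IsDivFree (v t))
    (L : EuclideanSpace ℝ (Fin 3) ≃ₗᵢ[ℝ] EuclideanSpace ℝ (Fin 3)) (c : EuclideanSpace ℝ (Fin 3)) {s : ℝ} (hs : s < 0)
    {U : Set (EuclideanSpace ℝ (Fin 3))} (hU : IsOpen U) (hne : U.Nonempty)
    (hinf : ∀ y ∈ U, fderiv ℝ (fun y => L.symm (v s (L y + c))) y (rotGen y) = rotGen (L.symm (v s (L y + c))))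
    (hsw : ∀ y ∈ U, swirl (fun y => L.symm (v s (L y + c))) y = 0) :
    ∀ t < 0, ∀ x, v t x = 0 := by
  -- the translated, then conjugated profile `w t y = L⁻¹ v(t, L y + c)` is in the class, so its slice `s` is analytic
  obtain ⟨hrate₁, hcont₁, hmild₁, -⟩ := class_translate c hrate hcont hmild hdiv
  obtain ⟨hrate₂, hcont₂, hmild₂, -⟩ := class_conj_linearIsometryEquiv L.symm hrate₁ hcont₁ hmild₁
    (fun t ht => ((class_translate c hrate hcont hmild hdiv).2.2.2 t ht))
  simp only [LinearIsometryEquiv.symm_symm] at hrate₂ hcont₂ hmild₂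
  have hw : AnalyticOnNhd ℝ (fun y => L.symm (v s (L y + c))) univ :=
    analyticOnNhd_slice hcont₂ (bdd_of_hasTypeITimeDecay hrate₂) hmild₂ hs
  exact eq_zero_of_axisymmetric_noSwirl_anyAxis_slice hrate hcont hmild hdiv L c hs
    (isAxisymmetric_of_fderiv_rotGen_window hw hU hne hinf) (hasNoSwirl_of_window hw hU hne hsw)

/-- … hence not backward-singular at the apex. -/
theorem nonflatLiouville_of_axisymmetric_noSwirl_germ_anyAxis_slice (hrate : HasTypeITimeDecay C v)
    (hcont : ContinuousOn (uncurry v) (Iio (0 : ℝ) ×ˢ univ))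
    (hmild : ∀ s t : ℝ, s < t → t < 0 → ∀ x,
      v t x = UnboundedOperators.heatExtension (v s) (t - s) x - oseenDuhamel 1 s v v t x)
    (hdiv : ∀ t < 0, VectorCalculus.IsDivFree (v t))
    (L : EuclideanSpace ℝ (Fin 3) ≃ₗᵢ[ℝ] EuclideanSpace ℝ (Fin 3)) (c : EuclideanSpace ℝ (Fin 3)) {s : ℝ} (hs : s < 0)
    {U : Set (EuclideanSpace ℝ (Fin 3))} (hU : IsOpen U) (hne : U.Nonempty)
    (hinf : ∀ y ∈ U, fderiv ℝ (fun y => L.symm (v s (L y + c))) y (rotGen y) = rotGen (L.symm (v s (L y + c))))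
    (hsw : ∀ y ∈ U, swirl (fun y => L.symm (v s (L y + c))) y = 0) :
    ¬ IsBackwardSingularPoint v 0 :=
  not_backwardSingular_of_zero
    (eq_zero_of_axisymmetric_noSwirl_germ_anyAxis_slice hrate hcont hmild hdiv L c hs hU hne hinf hsw)

/-! ### K2⁗ ⇐ the GERM quadrichotomy -/

/-- **K2⁗ `FrobeniusProfileRigidity` (profile form = hypothesis `hprofile` of the tree theorem
`localTubeDoorHelicity_of_profileRigidity`, verbatim) ⇐ THE GERM QUADRICHOTOMY.**  It suffices that every helicity-free
profile of the Type-I class has ONE slice `s < 0` and ONE nonempty open window `U` on which (1) the vorticity is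
parallel to a fixed `b ≠ 0`, or (2) the directional derivative `∂ₑ v(s)` vanishes for a fixed `e ≠ 0`, or (3) in some
rigid frame (`L`, `c`) the conjugated slice `y ↦ L⁻¹ v(s, L y + c)` is infinitesimally axisymmetric (`Dw(y)[J y] = J w(y)`)
and swirl-free, or (4) the vorticity is an affine screw field `k • (d × (y − c) + h • d)`, `k ≠ 0`, `d ≠ 0`.  Each
germ alternative spreads to the whole slice by real analyticity and lands in a settled tree stratum. -/
theorem frobeniusProfileRigidity_of_germQuadrichotomy
    (hgerm : ∀ (C : ℝ) (v : ℝ → EuclideanSpace ℝ (Fin 3) → EuclideanSpace ℝ (Fin 3)),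
      Literature.Analysis.FluidPDE.HasTypeITimeDecay C v →
      ContinuousOn (Function.uncurry v) (Set.Iio (0 : ℝ) ×ˢ Set.univ) →
      (∀ s t : ℝ, s < t → t < 0 → ∀ x, v t x =
        Literature.Analysis.UnboundedOperators.heatExtension (v s) (t - s) x -
          Literature.Analysis.FluidPDE.oseenDuhamel 1 s v v t x) →
      (∀ t < 0, Literature.Analysis.FluidPDE.VectorCalculus.IsDivFree (v t)) →
      (∀ s < 0, ∀ y : EuclideanSpace ℝ (Fin 3), ⟪v s y, Literature.Analysis.FluidPDE.curl (v s) y⟫_ℝ = 0) →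
      ∃ s < 0, ∃ U : Set (EuclideanSpace ℝ (Fin 3)), IsOpen U ∧ U.Nonempty ∧
        ((∃ b : EuclideanSpace ℝ (Fin 3), b ≠ 0 ∧
            ∀ y ∈ U, Literature.Analysis.FluidPDE.cross (Literature.Analysis.FluidPDE.curl (v s) y) b = 0) ∨
         (∃ e : EuclideanSpace ℝ (Fin 3), e ≠ 0 ∧ ∀ y ∈ U, fderiv ℝ (v s) y e = 0) ∨
         (∃ (L : EuclideanSpace ℝ (Fin 3) ≃ₗᵢ[ℝ] EuclideanSpace ℝ (Fin 3)) (c : EuclideanSpace ℝ (Fin 3)),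
            ∀ y ∈ U, fderiv ℝ (fun y => L.symm (v s (L y + c))) y (Literature.Analysis.FluidPDE.rotGen y) =
                Literature.Analysis.FluidPDE.rotGen (L.symm (v s (L y + c))) ∧
              Literature.Analysis.FluidPDE.swirl (fun y => L.symm (v s (L y + c))) y = 0) ∨
         (∃ (k : ℝ) (c d : EuclideanSpace ℝ (Fin 3)) (h : ℝ), k ≠ 0 ∧ d ≠ 0 ∧
            ∀ y ∈ U, Literature.Analysis.FluidPDE.curl (v s) y =
              k • (Literature.Analysis.FluidPDE.cross d (y - c) + h • d)))) :
    ∀ (C : ℝ) (v : ℝ → EuclideanSpace ℝ (Fin 3) → EuclideanSpace ℝ (Fin 3)),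
      Literature.Analysis.FluidPDE.HasTypeITimeDecay C v →
      ContinuousOn (Function.uncurry v) (Set.Iio (0 : ℝ) ×ˢ Set.univ) →
      (∀ s t : ℝ, s < t → t < 0 → ∀ x, v t x =
        Literature.Analysis.UnboundedOperators.heatExtension (v s) (t - s) x -
          Literature.Analysis.FluidPDE.oseenDuhamel 1 s v v t x) →
      (∀ t < 0, Literature.Analysis.FluidPDE.VectorCalculus.IsDivFree (v t)) →
      (∀ s < 0, ∀ y : EuclideanSpace ℝ (Fin 3), ⟪v s y, Literature.Analysis.FluidPDE.curl (v s) y⟫_ℝ = 0) →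
      ¬ Literature.Analysis.FluidPDE.IsBackwardSingularPoint v 0 := by
  intro C v hrate hcont hmild hdiv hhel
  obtain ⟨s, hs, U, hU, hne, halt⟩ := hgerm C v hrate hcont hmild hdiv hhel
  rcases halt with ⟨b, hb, hal⟩ | ⟨e, he, hdir⟩ | ⟨L, c, hax⟩ | ⟨k, c, d, h, -, -, hsc⟩
  · -- (1) window-aligned vorticity: tree `eq_zero_of_aligned_window`
    exact not_backwardSingular_of_zero (eq_zero_of_aligned_window hrate hcont hmild hdiv hs hb hU hne hal)
  · -- (2) one fading directional derivative on a window of one slice: the S13 one-slice crux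
    refine oneSliceCrux_dirDerivNorm he C v hrate hcont hmild hdiv ⟨s, hs, U, hU, hne, fun z hz => ?_⟩
    simpa only [norm_eq_zero] using hdir z hz
  · -- (3) germ-axisymmetric without swirl in the frame (L, c)
    exact nonflatLiouville_of_axisymmetric_noSwirl_germ_anyAxis_slice hrate hcont hmild hdiv L c hs hU hne
      (fun y hy => (hax y hy).1) (fun y hy => (hax y hy).2)
  · -- (4) affine screw vorticity on a window: nsreg-p5 g7's `eq_zero_of_screwVorticityBall`
    exact not_backwardSingular_of_zero (eq_zero_of_screwVorticityBall hrate hcont hmild hdiv hs k c d h hU hne hsc)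

/-- **The S11 leaf ⇐ THE GERM QUADRICHOTOMY** (composition with the tree theorem
`localTubeDoorHelicity_of_profileRigidity`: zoom K1‴, window Fatou and window → slab are all in the tree). -/
theorem localTubeDoorHelicity_of_germQuadrichotomy
    (hgerm : ∀ (C : ℝ) (v : ℝ → EuclideanSpace ℝ (Fin 3) → EuclideanSpace ℝ (Fin 3)),
      Literature.Analysis.FluidPDE.HasTypeITimeDecay C v →
      ContinuousOn (Function.uncurry v) (Set.Iio (0 : ℝ) ×ˢ Set.univ) →
      (∀ s t : ℝ, s < t → t < 0 → ∀ x, v t x =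
        Literature.Analysis.UnboundedOperators.heatExtension (v s) (t - s) x -
          Literature.Analysis.FluidPDE.oseenDuhamel 1 s v v t x) →
      (∀ t < 0, Literature.Analysis.FluidPDE.VectorCalculus.IsDivFree (v t)) →
      (∀ s < 0, ∀ y : EuclideanSpace ℝ (Fin 3), ⟪v s y, Literature.Analysis.FluidPDE.curl (v s) y⟫_ℝ = 0) →
      ∃ s < 0, ∃ U : Set (EuclideanSpace ℝ (Fin 3)), IsOpen U ∧ U.Nonempty ∧
        ((∃ b : EuclideanSpace ℝ (Fin 3), b ≠ 0 ∧
            ∀ y ∈ U, Literature.Analysis.FluidPDE.cross (Literature.Analysis.FluidPDE.curl (v s) y) b = 0) ∨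
         (∃ e : EuclideanSpace ℝ (Fin 3), e ≠ 0 ∧ ∀ y ∈ U, fderiv ℝ (v s) y e = 0) ∨
         (∃ (L : EuclideanSpace ℝ (Fin 3) ≃ₗᵢ[ℝ] EuclideanSpace ℝ (Fin 3)) (c : EuclideanSpace ℝ (Fin 3)),
            ∀ y ∈ U, fderiv ℝ (fun y => L.symm (v s (L y + c))) y (Literature.Analysis.FluidPDE.rotGen y) =
                Literature.Analysis.FluidPDE.rotGen (L.symm (v s (L y + c))) ∧
              Literature.Analysis.FluidPDE.swirl (fun y => L.symm (v s (L y + c))) y = 0) ∨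
         (∃ (k : ℝ) (c d : EuclideanSpace ℝ (Fin 3)) (h : ℝ), k ≠ 0 ∧ d ≠ 0 ∧
            ∀ y ∈ U, Literature.Analysis.FluidPDE.curl (v s) y =
              k • (Literature.Analysis.FluidPDE.cross d (y - c) + h • d)))) :
    ∀ (ν T : ℝ), 0 < ν → 0 < T → ∀ (u : ℝ → EuclideanSpace ℝ (Fin 3) → EuclideanSpace ℝ (Fin 3))
      (p : ℝ → EuclideanSpace ℝ (Fin 3) → ℝ),
    Literature.Analysis.FluidPDE.IsClassicalNSSolutionOn (Set.Ico 0 T) ν 0 u p →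
    Literature.Analysis.FluidPDE.IsLerayHopfOn T ν 0 (u 0) u →
    Literature.Analysis.FluidPDE.HasRapidSpatialDecay (u 0) →
    ∀ (x₀ : EuclideanSpace ℝ (Fin 3)) (ρ M : ℝ), 0 < ρ →
    (∀ t ∈ Set.Ico 0 T, T - ρ ^ 2 < t → ∀ x ∈ Metric.ball x₀ ρ, ‖u t x‖ * Real.sqrt (ν * (T - t)) ≤ M) →
    ∀ (U : Set (EuclideanSpace ℝ (Fin 3))), IsOpen U → U.Nonempty →
    Filter.Tendsto (fun t => ∫⁻ y in U, ENNReal.ofReal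
      |Real.sqrt (T - t) ^ 3 * ⟪u t (x₀ + Real.sqrt (T - t) • y),
        Literature.Analysis.FluidPDE.curl (u t) (x₀ + Real.sqrt (T - t) • y)⟫_ℝ|)
      (nhdsWithin T (Set.Iio T)) (nhds 0) →
    Literature.Analysis.FluidPDE.IsBackwardBoundedAt u T x₀ :=
  localTubeDoorHelicity_of_profileRigidity (frobeniusProfileRigidity_of_germQuadrichotomy hgerm)

/-- **The SLICE quadrichotomy implies the GERM quadrichotomy** (the converse direction of the reduction is trivial: a
global alternative on a slice holds on the window `univ`; axisymmetry gives `Dw(y)[J y] = J w(y)` by the tree lemma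
`IsAxisymmetric.fderiv_rotGen`, the slice being `C¹` by analyticity) — so the germ form is GENUINELY WEAKER as a
hypothesis, i.e. the reduction above sharpens the registered stub 1 of the line. -/
theorem germQuadrichotomy_of_sliceQuadrichotomy
    (hquad : ∀ (C : ℝ) (v : ℝ → EuclideanSpace ℝ (Fin 3) → EuclideanSpace ℝ (Fin 3)),
      Literature.Analysis.FluidPDE.HasTypeITimeDecay C v →
      ContinuousOn (Function.uncurry v) (Set.Iio (0 : ℝ) ×ˢ Set.univ) →
      (∀ s t : ℝ, s < t → t < 0 → ∀ x, v t x =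
        Literature.Analysis.UnboundedOperators.heatExtension (v s) (t - s) x -
          Literature.Analysis.FluidPDE.oseenDuhamel 1 s v v t x) →
      (∀ t < 0, Literature.Analysis.FluidPDE.VectorCalculus.IsDivFree (v t)) →
      (∀ s < 0, ∀ y : EuclideanSpace ℝ (Fin 3), ⟪v s y, Literature.Analysis.FluidPDE.curl (v s) y⟫_ℝ = 0) →
      ∃ s < 0,
        (∃ b : EuclideanSpace ℝ (Fin 3), b ≠ 0 ∧
          ∀ y, Literature.Analysis.FluidPDE.cross (Literature.Analysis.FluidPDE.curl (v s) y) b = 0) ∨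
        (∃ e : EuclideanSpace ℝ (Fin 3), e ≠ 0 ∧ ∀ (y : EuclideanSpace ℝ (Fin 3)) (l : ℝ), v s (y + l • e) = v s y) ∨
        (∃ (L : EuclideanSpace ℝ (Fin 3) ≃ₗᵢ[ℝ] EuclideanSpace ℝ (Fin 3)) (c : EuclideanSpace ℝ (Fin 3)),
          Literature.Analysis.FluidPDE.IsAxisymmetric (fun y => L.symm (v s (L y + c))) ∧
          Literature.Analysis.FluidPDE.HasNoSwirl (fun y => L.symm (v s (L y + c)))) ∨
        (∃ (k : ℝ) (c d : EuclideanSpace ℝ (Fin 3)) (h : ℝ) (U : Set (EuclideanSpace ℝ (Fin 3))),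
          k ≠ 0 ∧ d ≠ 0 ∧ IsOpen U ∧ U.Nonempty ∧
          ∀ y ∈ U, Literature.Analysis.FluidPDE.curl (v s) y =
            k • (Literature.Analysis.FluidPDE.cross d (y - c) + h • d))) :
    ∀ (C : ℝ) (v : ℝ → EuclideanSpace ℝ (Fin 3) → EuclideanSpace ℝ (Fin 3)),
      Literature.Analysis.FluidPDE.HasTypeITimeDecay C v →
      ContinuousOn (Function.uncurry v) (Set.Iio (0 : ℝ) ×ˢ Set.univ) →
      (∀ s t : ℝ, s < t → t < 0 → ∀ x, v t x =
        Literature.Analysis.UnboundedOperators.heatExtension (v s) (t - s) x -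
          Literature.Analysis.FluidPDE.oseenDuhamel 1 s v v t x) →
      (∀ t < 0, Literature.Analysis.FluidPDE.VectorCalculus.IsDivFree (v t)) →
      (∀ s < 0, ∀ y : EuclideanSpace ℝ (Fin 3), ⟪v s y, Literature.Analysis.FluidPDE.curl (v s) y⟫_ℝ = 0) →
      ∃ s < 0, ∃ U : Set (EuclideanSpace ℝ (Fin 3)), IsOpen U ∧ U.Nonempty ∧
        ((∃ b : EuclideanSpace ℝ (Fin 3), b ≠ 0 ∧
            ∀ y ∈ U, Literature.Analysis.FluidPDE.cross (Literature.Analysis.FluidPDE.curl (v s) y) b = 0) ∨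
         (∃ e : EuclideanSpace ℝ (Fin 3), e ≠ 0 ∧ ∀ y ∈ U, fderiv ℝ (v s) y e = 0) ∨
         (∃ (L : EuclideanSpace ℝ (Fin 3) ≃ₗᵢ[ℝ] EuclideanSpace ℝ (Fin 3)) (c : EuclideanSpace ℝ (Fin 3)),
            ∀ y ∈ U, fderiv ℝ (fun y => L.symm (v s (L y + c))) y (Literature.Analysis.FluidPDE.rotGen y) =
                Literature.Analysis.FluidPDE.rotGen (L.symm (v s (L y + c))) ∧
              Literature.Analysis.FluidPDE.swirl (fun y => L.symm (v s (L y + c))) y = 0) ∨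
         (∃ (k : ℝ) (c d : EuclideanSpace ℝ (Fin 3)) (h : ℝ), k ≠ 0 ∧ d ≠ 0 ∧
            ∀ y ∈ U, Literature.Analysis.FluidPDE.curl (v s) y =
              k • (Literature.Analysis.FluidPDE.cross d (y - c) + h • d))) := by
  intro C v hrate hcont hmild hdiv hhel
  obtain ⟨s, hs, halt⟩ := hquad C v hrate hcont hmild hdiv hhel
  rcases halt with ⟨b, hb, hal⟩ | ⟨e, he, htr⟩ | ⟨L, c, hax, hsw⟩ | ⟨k, c, d, h, U, hk, hd, hU, hne, hsc⟩
  · exact ⟨s, hs, univ, isOpen_univ, univ_nonempty, Or.inl ⟨b, hb, fun y _ => hal y⟩⟩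
  · refine ⟨s, hs, univ, isOpen_univ, univ_nonempty, Or.inr (Or.inl ⟨e, he, fun y _ => ?_⟩)⟩
    -- a translation-invariant slice has vanishing directional derivative along `e`
    have hconst : ∀ l : ℝ, v s (y + l • e) = v s y := fun l => htr y l
    have hline : HasDerivAt (fun l : ℝ => v s (y + l • e)) (fderiv ℝ (v s) y e) 0 := by
      have hd : DifferentiableAt ℝ (v s) y :=
        ((analyticOnNhd_slice hcont (bdd_of_hasTypeITimeDecay hrate) hmild hs) y (mem_univ y)).differentiableAt
      have h1 : HasDerivAt (fun l : ℝ => y + l • e) e 0 := by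
        simpa using ((hasDerivAt_id (0 : ℝ)).smul_const e).const_add y
      exact hd.hasFDerivAt.comp_hasDerivAt_of_eq 0 h1 (by simp)
    have hzero : HasDerivAt (fun l : ℝ => v s (y + l • e)) 0 0 := by
      have : (fun l : ℝ => v s (y + l • e)) = fun _ => v s y := funext hconst
      rw [this]; exact hasDerivAt_const 0 (v s y)
    exact hline.unique hzero
  · refine ⟨s, hs, univ, isOpen_univ, univ_nonempty, Or.inr (Or.inr (Or.inl ⟨L, c, fun y _ => ⟨?_, hsw y⟩⟩))⟩
    -- an axisymmetric analytic slice is infinitesimally axisymmetric (tree `IsAxisymmetric.fderiv_rotGen`)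
    obtain ⟨hrate₁, hcont₁, hmild₁, hdiv₁⟩ := class_translate c hrate hcont hmild hdiv
    obtain ⟨hrate₂, hcont₂, hmild₂, -⟩ := class_conj_linearIsometryEquiv L.symm hrate₁ hcont₁ hmild₁ hdiv₁
    simp only [LinearIsometryEquiv.symm_symm] at hrate₂ hcont₂ hmild₂
    have hw : AnalyticOnNhd ℝ (fun y => L.symm (v s (L y + c))) univ :=
      analyticOnNhd_slice hcont₂ (bdd_of_hasTypeITimeDecay hrate₂) hmild₂ hs
    exact hax.fderiv_rotGen (hw y (mem_univ y)).differentiableAt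
  · exact ⟨s, hs, U, hU, hne, Or.inr (Or.inr (Or.inr ⟨k, c, d, h, hk, hd, hsc⟩))⟩

end Summit.NavierStokesRegularity.NavierStokesRegularity.Theorems.LocalHelicityTubeDoorFrobeniusProfileRigidityGermQuadrichotomy

end
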